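import Summits.RiemannHypothesis.RiemannHypothesis.Theorems.UniversalFactorLehmerTails

/-!
# RiemannHypothesis / UniversalFactor — cell decomposition of the backward one-sided average

Route `RiemannHypothesis/UniversalFactor`, computation crux `MediumKernelNoGo`
(stmt-RiemannHypothesis-2577), line *one-sided-average-sign-test*, stub `stub_highSideP`.

The dip certificate at `x₀ = 2t₀` evaluates the backward one-sided Laplace average
`∫₀^∞ H_0(2t₀ − y) e^{−ay} dy` (`H_0 = deBruijnH 0`, real on the real axis) by certified quadrature
on `Cy` cells of half-width `ρ` in the variable `t = t₀ − y/2`, plus a tail from `Y = 4ρ·Cy`.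
This file is the pure bookkeeping behind that:

* `UniversalFactor.highSideP_integrand_eq` — the complex integrand is the cast of the real function
  `Re H_0(2t₀ − y) · e^{−ay}`;
* `UniversalFactor.highSideP_integrableOn` — integrability on `(0, ∞)` (`|H_0| ≤ ¼` on `ℝ`);
* `UniversalFactor.highSideP_real` — for a real integrand: split `(0, ∞)` at `Y`, substitute
  `y = 2(t₀ − t)` on `(0, Y]`, and cut the `t`-range `[t₀ − 2ρCy, t₀]` into the `Cy` adjacent cells
  `[t₀ − (2c+1)ρ − ρ, t₀ − (2c+1)ρ + ρ]`;
* `UniversalFactor.stub_highSideP` — the registered identity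
  `Re ∫₀^∞ H_0(2t₀ − y) e^{−ay} dy = 2 Σ_c ∫_{cell c} Re H_0(2t) e^{2a(t − t₀)} dt + Re ∫_Y^∞ …`.

References: E. C. Titchmarsh, *The Theory of the Riemann Zeta-Function* (1986), §10.1.
-/

set_option linter.dupNamespace false

noncomputable section

namespace Summit.RiemannHypothesis.RiemannHypothesis.Theorems

open Set MeasureTheory intervalIntegral Finset
open Literature.NumberTheory.LFunctions

/-- The backward integrand `H_0(2t₀ − y) e^{−ay}` is the complexification of the real function
`Re H_0(2t₀ − y) · e^{−ay}` (`H_0` is real on the real axis). [folklore] -/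
theorem UniversalFactor.highSideP_integrand_eq (t₀ a y : ℝ) :
    deBruijnH 0 (((2 * t₀ : ℝ) : ℂ) - y) * (Real.exp (-(a * y)) : ℂ) =
      (((deBruijnH 0 (((2 * t₀ : ℝ) : ℂ) - y)).re * Real.exp (-(a * y)) : ℝ) : ℂ) := by
  have him : (deBruijnH 0 (((2 * t₀ : ℝ) : ℂ) - y)).im = 0 := by
    rw [show (((2 * t₀ : ℝ) : ℂ) - (y : ℂ)) = ((2 * t₀ - y : ℝ) : ℂ) by push_cast; ring,
      ← deBruijnHDiv_one']
    exact deBruijnHDiv_ofReal_im _ _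
  have hre : (((deBruijnH 0 (((2 * t₀ : ℝ) : ℂ) - y)).re : ℝ) : ℂ) =
      deBruijnH 0 (((2 * t₀ : ℝ) : ℂ) - y) :=
    Complex.ext (by rw [Complex.ofReal_re]) (by rw [Complex.ofReal_im, him])
  rw [Complex.ofReal_mul _ (Real.exp (-(a * y))), hre]

/-- Integrability on `(0, ∞)` of the real backward integrand `Re H_0(2t₀ − y) · e^{−ay}` for `a > 0`
(`|H_0| ≤ ¼` on the real axis, `H_0` continuous, `e^{−ay}` integrable). [folklore] -/
theorem UniversalFactor.highSideP_integrableOn {a : ℝ} (ha : 0 < a) (t₀ : ℝ) :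
    IntegrableOn (fun y : ℝ => (deBruijnH 0 (((2 * t₀ : ℝ) : ℂ) - y)).re * Real.exp (-(a * y)))
      (Set.Ioi 0) := by
  have hcont : Continuous fun y : ℝ =>
      (deBruijnH 0 (((2 * t₀ : ℝ) : ℂ) - y)).re * Real.exp (-(a * y)) := by
    have h1 : Continuous fun y : ℝ => deBruijnH 0 (((2 * t₀ : ℝ) : ℂ) - y) :=
      continuous_deBruijnH_zero.comp (continuous_const.sub Complex.continuous_ofReal)
    exact (Complex.continuous_re.comp h1).mul (by fun_prop)
  refine Integrable.mono' ((exp_neg_integrableOn_Ioi 0 ha).const_mul (1 / 4))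
    hcont.aestronglyMeasurable (Filter.Eventually.of_forall fun y => ?_)
  rw [norm_mul, Real.norm_of_nonneg (Real.exp_pos _).le, neg_mul, Real.norm_eq_abs]
  refine mul_le_mul_of_nonneg_right ((Complex.abs_re_le_norm _).trans ?_) (Real.exp_pos _).le
  rw [show (((2 * t₀ : ℝ) : ℂ) - (y : ℂ)) = ((2 * t₀ - y : ℝ) : ℂ) by push_cast; ring]
  exact UniversalFactor.norm_deBruijnH_zero_le_quarter _

/-- The cell integrand `t ↦ Re H_0(2t) · e^{2a(t − t₀)}` is continuous. [folklore] -/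
theorem UniversalFactor.highSideP_continuous_cell (a t₀ : ℝ) :
    Continuous fun t : ℝ =>
      (deBruijnH 0 ((2 * t : ℝ) : ℂ)).re * Real.exp (-(-(2 * a)) * (t - t₀)) := by
  have h1 : Continuous fun t : ℝ => deBruijnH 0 ((2 * t : ℝ) : ℂ) :=
    continuous_deBruijnH_zero.comp
      (Complex.continuous_ofReal.comp (continuous_const.mul continuous_id))
  exact (Complex.continuous_re.comp h1).mul (by fun_prop)

/-- Real bookkeeping: for `g` integrable on `(0, ∞)`, `h` continuous with `g(2t₀ − 2t) = h(t)` and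
`ρ ≥ 0`: `∫₀^∞ g = 2 Σ_{c<Cy} ∫_{t₀−(2c+1)ρ−ρ}^{t₀−(2c+1)ρ+ρ} h + ∫_{4ρCy}^∞ g`
(split at `Y = 4ρCy`, substitute `y = 2(t₀ − t)`, adjacent cells). [folklore] -/
theorem UniversalFactor.highSideP_real {g h : ℝ → ℝ} (t₀ : ℝ) {ρ : ℝ} (Cy : ℕ) (hρ : 0 ≤ ρ)
    (hg : IntegrableOn g (Set.Ioi 0)) (hh : Continuous h) (hgh : ∀ t, g (2 * t₀ - 2 * t) = h t) :
    ∫ y in Set.Ioi 0, g y =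
      2 * (∑ c ∈ Finset.range Cy,
        ∫ t in (t₀ - (2 * c + 1) * ρ - ρ)..(t₀ - (2 * c + 1) * ρ + ρ), h t) +
      ∫ y in Set.Ioi (4 * ρ * Cy), g y := by
  have hY : (0:ℝ) ≤ 4 * ρ * Cy := by positivity
  -- split `(0, ∞)` at `Y`
  rw [← Set.Ioc_union_Ioi_eq_Ioi hY, MeasureTheory.setIntegral_union Set.Ioc_disjoint_Ioi_same
    measurableSet_Ioi (hg.mono_set Set.Ioc_subset_Ioi_self) (hg.mono_set (Set.Ioi_subset_Ioi hY)),
    ← intervalIntegral.integral_of_le hY, add_left_inj]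
  -- substitute `y = 2 (t₀ - t)`
  have hsub := intervalIntegral.integral_comp_sub_mul (a := t₀ - 2 * ρ * Cy) (b := t₀) g
    two_ne_zero (2 * t₀)
  rw [show 2 * t₀ - 2 * t₀ = (0:ℝ) by ring,
    show 2 * t₀ - 2 * (t₀ - 2 * ρ * Cy) = 4 * ρ * Cy by ring, smul_eq_mul] at hsub
  have h2 : ∫ y in (0:ℝ)..(4 * ρ * Cy), g y =
      2 * ∫ x in (t₀ - 2 * ρ * Cy)..t₀, g (2 * t₀ - 2 * x) := by
    rw [hsub]; ring
  rw [h2]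
  congr 1
  simp_rw [hgh]
  -- adjacent cells
  have hadj := intervalIntegral.sum_integral_adjacent_intervals (f := h) (μ := volume)
    (a := fun k : ℕ => t₀ - 2 * ρ * k) (n := Cy) (fun k _ => hh.intervalIntegrable _ _)
  simp only [Nat.cast_zero, mul_zero, sub_zero] at hadj
  rw [intervalIntegral.integral_symm t₀ (t₀ - 2 * ρ * Cy), ← hadj, ← Finset.sum_neg_distrib]
  refine Finset.sum_congr rfl fun c _ => ?_
  rw [← intervalIntegral.integral_symm]
  have e1 : t₀ - 2 * ρ * ((c + 1 : ℕ) : ℝ) = t₀ - (2 * c + 1) * ρ - ρ := by push_cast; ring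
  have e2 : t₀ - 2 * ρ * (c : ℝ) = t₀ - (2 * c + 1) * ρ + ρ := by ring
  rw [e1, e2]

/-- **Cell decomposition of the backward one-sided average** (line *one-sided-average-sign-test*):
for `a > 0`, `ρ > 0` and `Cy` cells,
`Re ∫₀^∞ H_0(2t₀ − y) e^{−ay} dy`
`= 2 · Σ_{c<Cy} ∫_{t₀−(2c+1)ρ−ρ}^{t₀−(2c+1)ρ+ρ} Re H_0(2t) e^{2a(t−t₀)} dt`
`+ Re ∫_{4ρCy}^∞ H_0(2t₀ − y) e^{−ay} dy`
(substitution `t = t₀ − y/2`). [folklore] -/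
theorem UniversalFactor.stub_highSideP :
    ∀ (t₀ a ρ : ℝ) (Cy : ℕ), 0 < a → 0 < ρ →
      (∫ y in Set.Ioi (0:ℝ), deBruijnH 0 (((2 * t₀ : ℝ) : ℂ) - y) * (Real.exp (-(a * y)) : ℂ)).re =
        2 * (∑ c ∈ Finset.range Cy,
          ∫ t in (t₀ - (2 * c + 1) * ρ - ρ)..(t₀ - (2 * c + 1) * ρ + ρ),
            (deBruijnH 0 ((2 * t : ℝ) : ℂ)).re * Real.exp (-(-(2 * a)) * (t - t₀))) +
        (∫ y in Set.Ioi (4 * ρ * Cy),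
          deBruijnH 0 (((2 * t₀ : ℝ) : ℂ) - y) * (Real.exp (-(a * y)) : ℂ)).re := by
  intro t₀ a ρ Cy ha hρ
  simp_rw [UniversalFactor.highSideP_integrand_eq, integral_complex_ofReal, Complex.ofReal_re]
  refine UniversalFactor.highSideP_real t₀ Cy hρ.le (UniversalFactor.highSideP_integrableOn ha t₀)
    (UniversalFactor.highSideP_continuous_cell a t₀) (fun t => ?_)
  show (deBruijnH 0 (((2 * t₀ : ℝ) : ℂ) - ((2 * t₀ - 2 * t : ℝ) : ℂ))).re *
      Real.exp (-(a * (2 * t₀ - 2 * t))) =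
    (deBruijnH 0 ((2 * t : ℝ) : ℂ)).re * Real.exp (-(-(2 * a)) * (t - t₀))
  have e1 : (((2 * t₀ : ℝ) : ℂ) - ((2 * t₀ - 2 * t : ℝ) : ℂ)) = ((2 * t : ℝ) : ℂ) := by
    push_cast; ring
  have e2 : -(a * (2 * t₀ - 2 * t)) = -(-(2 * a)) * (t - t₀) := by ring
  rw [e1, e2]

end Summit.RiemannHypothesis.RiemannHypothesis.Theorems
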